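import Summits.BirchSwinnertonDyer.BirchSwinnertonDyer.Theorems.ThetaPartnerAtTwoSignedControlAtTwoCyclicLiftTools
import HarnessLib

/-!
# The `Γ`-lift from `p`-adic CYCLICITY: an abstract lemma on an endomorphism `σ` of an abelian group
# (K4 `SignedControlAtTwo`, stmt-BirchSwinnertonDyer-20309, line `eulerchar`; the algebra under «INJ⁺@2 ⟸ CYC⁺@2»)

Route `ThetaPartnerAtTwo` (TP2; crux shared with `ResidualThetaTransportAtTwo`), crux K4, lead seat
`prover-bsd-wall-tp2-p3` (g2). PURE ALGEBRA, no number theory: the finite-level argument that turns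
"`E⁺(ℚ_{2,n})` is `2`-adically cyclic over `ℤ[σ]`" into B. D. Kim's lift
«`(E⁺ ⊗ ℚ_p/ℤ_p)^Γ = E(ℚ_p) ⊗ ℚ_p/ℤ_p`» (the hypothesis (LIFT) of
`…SignedControlAtTwoPlusLocalInjOfLift`, seat w3), WITHOUT ranks, without `ω_n^±`, without completions.

## Statement (`exists_sub_zsmul_eq_pow_nsmul_of_cyclic`)

Let `B` be an additive commutative group, `σ : B →ₗ[ℤ] B`, `p` a prime, `A ≤ B` a `σ`-stable subgroup
with no `p`-torsion on which some power `σ^N` (`N ≥ 1`) fixes `e`, `e ∈ A` a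
**`p`-adic cyclic generator** — for every `K` and every `x ∈ A` there is `P ∈ ℤ[X]` with
`x − P(σ)e ∈ p^K A` — and `a₀ ∈ A` a `σ`-fixed element with `a₀ ∉ pA`. Then for every `x ∈ A` and `k`:
`σx − x ∈ p^k A ⇒ x ∈ ℤa₀ + p^k A`.

## Proof (Kobayashi-free; what replaces «`(E^±(k_∞) ⊗ ℚ_p/ℤ_p)^∨ ≅ Λ`»)

Write `F·x = F(σ)x` (`Polynomial.aeval`), `S = {F : F·e ∈ pA}` (an ideal of `ℤ[X]` containing `p` and
`X^N − 1`), `d` = the least degree of a MONIC member of `S` (`d ≥ 1` since `a₀ ∉ pA`).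
(1a) a member of `S` of degree `< d` is divisible by `p` (else a Bézout combination with `pX^m` is a
monic member of smaller degree); (1b) hence, by the absence of `p`-torsion, a polynomial of degree
`< d` with `F·e ∈ p^j A` is divisible by `p^j`; (1c) Nakayama: every `x ∈ A` is `P·e` modulo `p^j A`
with `deg P < d`; (1d) applied to `X^d·e` this gives a monic `f` of degree `d` with `f·e ∈ p^K A`,
and (1e) `F·e ∈ p^K A ⇒ F ∈ (f) + p^K ℤ[X]`. (2) `f` kills ALL of `A` modulo `p^K`, in particular
`f(1)·a₀ ∈ p^K A`, which forces `p^K ∣ f(1)` (`a₀ ∉ pA`, no `p`-torsion); so one may take `f(1) = 0`,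
`f = (X − 1)g`. (3) `b := g·e` is `σ`-fixed modulo `p^K` and `a₀ ≡ u·b` with `p ∤ u`, so
`b ≡ m·a₀ (mod p^K A)`. (4) If `σx − x ∈ p^k A`, `x ≡ P·e`, then `(X−1)P ∈ ((X−1)g) + p^k ℤ[X]`, so
`P ∈ (g) + p^kℤ[X]` (cancel `X − 1` in the domain `ℤ[X]`) and `x ≡ q(1)·b ≡ q(1)m·a₀`.
In the application (`A = E⁺(ℚ_{2,n})`, `σ` a local Galois element) this is exactly the statement that
the `2`-adic annihilator of a cyclic generator is `(X−1)·g` with `g ∣ ν_n`, whence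
`H¹(Gal(ℚ_{2,n}/ℚ₂), E⁺(ℚ_{2,n})) = 0` — the finite-level shadow computed by cell `bsd-2adic`
(GEN 4: `d(Λ⁺) = 1`, `h¹(Λ⁺) = 1` for `n ≤ 7`).

HONEST FRAMING: THEOREMS ONLY (no definition, no named fact, no `sorry`), route-independent; nothing
about any curve is asserted; closes no item; BSD is not proved by any of this.

References: [Kobayashi2003] S. Kobayashi, Invent. Math. 152 (2003) §8.4 (Props. 8.11–8.12: cyclic
generation of `E^±` by the points `c_n`), Thm. 6.2, Prop. 9.2; [BDKim2013] B. D. Kim, J. Aust. Math.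
Soc. 95 (2013), proof of Cor. 3.15 («`g_v` is injective»); [AtiyahMacdonald1969] Prop. 2.6 (Nakayama).
-/

set_option autoImplicit false
-- the Theorems namespace of this sub repeats the summit name by design (D-0017 nested layout)
set_option linter.dupNamespace false

noncomputable section

open scoped Classical
open Polynomial

namespace Summit.BirchSwinnertonDyer.BirchSwinnertonDyer.Theorems.SignedEC.CyclicLift

variable {B : Type*} [AddCommGroup B] (σ : Module.End ℤ B)

/-! ## §3 `F·e ∈ p^K A`: the ideal `S` and its minimal monic degree -/

section Cyclic

variable {A : AddSubgroup B} {p : ℕ} {e : B}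

/-- `S_K := {F : F·e ∈ p^K A}` is closed under addition. [folklore] -/
private theorem divAt_add {K : ℕ} {F G : ℤ[X]} (hF : (∃ y ∈ A, aeval σ F e = p ^ K • y)) (hG : (∃ y ∈ A, aeval σ G e = p ^ K • y)) :
    (∃ y ∈ A, aeval σ (F + G) e = p ^ K • y) := by
  obtain ⟨y, hy, hFy⟩ := hF; obtain ⟨z, hz, hGz⟩ := hG
  exact ⟨y + z, A.add_mem hy hz, by rw [map_add, LinearMap.add_apply, hFy, hGz, smul_add]⟩

/-- `S_K` is closed under subtraction. [folklore] -/
private theorem divAt_sub {K : ℕ} {F G : ℤ[X]} (hF : (∃ y ∈ A, aeval σ F e = p ^ K • y)) (hG : (∃ y ∈ A, aeval σ G e = p ^ K • y)) :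
    (∃ y ∈ A, aeval σ (F - G) e = p ^ K • y) := by
  obtain ⟨y, hy, hFy⟩ := hF; obtain ⟨z, hz, hGz⟩ := hG
  exact ⟨y - z, A.sub_mem hy hz, by rw [map_sub, LinearMap.sub_apply, hFy, hGz, smul_sub]⟩

/-- `S_K` is closed under multiplication by `ℤ[X]` (`A` is `σ`-stable). [folklore] -/
private theorem divAt_mul_left (hA : ∀ x ∈ A, σ x ∈ A) {K : ℕ} (G : ℤ[X]) {F : ℤ[X]} (hF : (∃ y ∈ A, aeval σ F e = p ^ K • y)) :
    (∃ y ∈ A, aeval σ (G * F) e = p ^ K • y) := by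
  obtain ⟨y, hy, hFy⟩ := hF
  exact ⟨aeval σ G y, aeval_apply_mem σ hA G hy, by rw [aeval_mul_apply, hFy, aeval_apply_nsmul]⟩

/-- `c p^K F ∈ S_K`. [folklore] -/
private theorem divAt_C_mul_pow (hA : ∀ x ∈ A, σ x ∈ A) (he : e ∈ A) (K : ℕ) (c : ℤ) (F : ℤ[X]) :
    (∃ y ∈ A, aeval σ (C (c * (p : ℤ) ^ K) * F) e = p ^ K • y) :=
  ⟨c • aeval σ F e, A.zsmul_mem (aeval_apply_mem σ hA F he) c, by
    rw [aeval_C_mul_apply, mul_comm, mul_smul, ← Nat.cast_pow, natCast_zsmul]⟩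

/-- `X^N − 1 ∈ S_K` when `σ^N` fixes `e`. [folklore] -/
private theorem divAt_X_pow_sub_one (K : ℕ) {N : ℕ} (hN : (σ ^ N) e = e) : (∃ y ∈ A, aeval σ (X ^ N - C 1 : ℤ[X]) e = p ^ K • y) :=
  ⟨0, A.zero_mem, by
    rw [map_sub, LinearMap.sub_apply, aeval_X_pow_apply, hN, aeval_C_apply, one_smul, sub_self, smul_zero]⟩

/-- `S_{K+1} ⊆ S_1`. [folklore] -/
private theorem divAt_one_of_divAt_succ {K : ℕ} {F : ℤ[X]} (hF : (∃ y ∈ A, aeval σ F e = p ^ (K + 1) • y)) : (∃ y ∈ A, aeval σ F e = p ^ 1 • y) := by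
  obtain ⟨y, hy, hFy⟩ := hF
  exact ⟨p ^ K • y, A.nsmul_mem hy _, by rw [hFy, ← mul_smul, pow_one, ← pow_succ']⟩

/-- `S_1` has a monic member (`X^N − 1`). [folklore] -/
private theorem monicAt_exists {N : ℕ} (hN : 0 < N) (hper : (σ ^ N) e = e) : ∃ m, (∃ φ : ℤ[X], φ.Monic ∧ φ.natDegree = m ∧ ∃ y ∈ A, aeval σ φ e = p ^ 1 • y) :=
  ⟨N, X ^ N - C 1, monic_X_pow_sub_C (1 : ℤ) hN.ne', by rw [natDegree_X_pow_sub_C], divAt_X_pow_sub_one σ 1 hper⟩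

/-- (1a) With `d` a lower bound for the degrees of the monic members of `S`, every member of `S` of
degree `< d` is divisible by `p`. [folklore] -/
private theorem C_dvd_of_divAt_one (hA : ∀ x ∈ A, σ x ∈ A) (he : e ∈ A) (hp : p.Prime) {d : ℕ}
    (hdmin : ∀ m, (∃ φ : ℤ[X], φ.Monic ∧ φ.natDegree = m ∧ ∃ y ∈ A, aeval σ φ e = p ^ 1 • y) → d ≤ m) {F : ℤ[X]} (hF : (∃ y ∈ A, aeval σ F e = p ^ 1 • y)) (hFd : F.natDegree < d) :
    C (p : ℤ) ∣ F := by
  obtain ⟨n, hn⟩ : ∃ n, F.natDegree = n := ⟨_, rfl⟩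
  induction n using Nat.strong_induction_on generalizing F with
  | _ n ih =>
    by_cases hF0 : F = 0
    · rw [hF0]; exact dvd_zero _
    by_cases hpc : (p : ℤ) ∣ F.leadingCoeff
    · -- erase the `p`-divisible leading term and use the induction hypothesis
      obtain ⟨c', hc'⟩ := hpc
      have hlead : (∃ y ∈ A, aeval σ (C F.leadingCoeff * X ^ F.natDegree) e = p ^ 1 • y) := by
        rw [hc', mul_comm (p : ℤ) c', ← pow_one (p : ℤ)]
        exact divAt_C_mul_pow σ hA he 1 c' _
      have hEq : F.eraseLead = F - C F.leadingCoeff * X ^ F.natDegree :=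
        eq_sub_of_add_eq F.eraseLead_add_C_mul_X_pow
      have hE : (∃ y ∈ A, aeval σ F.eraseLead e = p ^ 1 • y) := hEq ▸ divAt_sub σ hF hlead
      have hdvdE : C (p : ℤ) ∣ F.eraseLead := by
        rcases F.eraseLead_natDegree_lt_or_eraseLead_eq_zero with hlt | h0
        · exact ih F.eraseLead.natDegree (hn ▸ hlt) hE (hlt.trans hFd) rfl
        · rw [h0]; exact dvd_zero _
      rw [← F.eraseLead_add_C_mul_X_pow]
      exact dvd_add hdvdE ⟨C c' * X ^ F.natDegree, by rw [hc', C_mul, mul_assoc]⟩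
    · -- a Bézout combination with `p X^m` would be a monic member of `S` of degree `< d`
      exfalso
      obtain ⟨u, v, huv⟩ := ((Nat.prime_iff_prime_int.mp hp).coprime_iff_not_dvd).mpr hpc
      set G : ℤ[X] := C v * F + C (u * (p : ℤ) ^ 1) * X ^ F.natDegree with hG
      have hGdeg : G.natDegree ≤ F.natDegree :=
        (natDegree_add_le _ _).trans (max_le (natDegree_C_mul_le _ _) (natDegree_C_mul_X_pow_le _ _))
      have hGcoeff : G.coeff F.natDegree = 1 := by
        rw [hG, coeff_add, coeff_C_mul, coeff_C_mul, coeff_X_pow_self, mul_one, coeff_natDegree, pow_one, ← huv]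
        ring
      have hGmonic : G.Monic := monic_of_natDegree_le_of_coeff_eq_one _ hGdeg hGcoeff
      have hGnat : G.natDegree = F.natDegree :=
        le_antisymm hGdeg (le_natDegree_of_ne_zero (by rw [hGcoeff]; exact one_ne_zero))
      have hGS : (∃ y ∈ A, aeval σ G e = p ^ 1 • y) :=
        divAt_add σ (divAt_mul_left σ hA (C v) hF) (divAt_C_mul_pow σ hA he 1 u _)
      have := hdmin _ ⟨G, hGmonic, hGnat, hGS⟩
      omega

/-- (1b) A polynomial of degree `< d` with `F·e ∈ p^j A` is divisible by `p^j`. [folklore] -/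
private theorem C_pow_dvd_of_divAt (hA : ∀ x ∈ A, σ x ∈ A) (he : e ∈ A) (hp : p.Prime)
    (hnt : ∀ x ∈ A, p • x = 0 → x = 0) {d : ℕ} (hdmin : ∀ m, (∃ φ : ℤ[X], φ.Monic ∧ φ.natDegree = m ∧ ∃ y ∈ A, aeval σ φ e = p ^ 1 • y) → d ≤ m) (j : ℕ) {F : ℤ[X]}
    (hF : (∃ y ∈ A, aeval σ F e = p ^ j • y)) (hFd : F.natDegree < d) : C ((p : ℤ) ^ j) ∣ F := by
  induction j generalizing F with
  | zero => rw [pow_zero, C_1]; exact one_dvd _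
  | succ j ih =>
    obtain ⟨F', rfl⟩ := C_dvd_of_divAt_one σ hA he hp hdmin (divAt_one_of_divAt_succ σ hF) hFd
    have hp0 : (p : ℤ) ≠ 0 := by exact_mod_cast hp.ne_zero
    have hF'd : F'.natDegree < d := by rwa [natDegree_C_mul hp0] at hFd
    obtain ⟨y, hy, hFy⟩ := hF
    have hF' : (∃ y ∈ A, aeval σ F' e = p ^ j • y) := by
      refine ⟨y, hy, nsmul_cancel (A := A) hnt (aeval_apply_mem σ hA F' he) (A.nsmul_mem hy _) ?_⟩
      rw [← natCast_zsmul, ← aeval_C_mul_apply, hFy, ← mul_smul, ← pow_succ']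
    rw [pow_succ', C_mul]
    exact mul_dvd_mul_left _ (ih hF' hF'd)

/-- (1c) Nakayama: modulo `pA` every `x ∈ A` is `P·e` with `deg P < d` (`φ` a monic member of `S` of
degree `d ≥ 1`). [folklore] -/
private theorem exists_lt_divAt_one (hA : ∀ x ∈ A, σ x ∈ A) {d : ℕ} (hd : 0 < d) {φ : ℤ[X]} (hφ : φ.Monic)
    (hφd : φ.natDegree = d) (hφS : (∃ y ∈ A, aeval σ φ e = p ^ 1 • y))
    (hgen : ∀ x ∈ A, ∃ P : ℤ[X], ∃ y ∈ A, x - aeval σ P e = p ^ 1 • y) {x : B} (hx : x ∈ A) :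
    ∃ P : ℤ[X], P.natDegree < d ∧ ∃ y ∈ A, x - aeval σ P e = p ^ 1 • y := by
  obtain ⟨P, y, hy, hPy⟩ := hgen x hx
  have hφ1 : φ ≠ 1 := fun h ↦ by rw [h, natDegree_one] at hφd; omega
  refine ⟨P %ₘ φ, hφd ▸ natDegree_modByMonic_lt P hφ hφ1, ?_⟩
  obtain ⟨z, hz, hφz⟩ := divAt_mul_left σ hA (P /ₘ φ) hφS
  refine ⟨y + z, A.add_mem hy hz, ?_⟩
  have hP : P = P %ₘ φ + P /ₘ φ * φ := by rw [mul_comm]; exact (modByMonic_add_div P φ).symm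
  have hmod : aeval σ (P %ₘ φ) e = aeval σ P e - aeval σ (P /ₘ φ * φ) e := by
    rw [eq_sub_iff_add_eq, ← LinearMap.add_apply, ← map_add, ← hP]
  rw [hmod, smul_add, ← hPy, ← hφz]
  abel

/-- (1c′) … and modulo `p^j A`, for every `j`. [folklore] -/
private theorem exists_lt_divAt (hA : ∀ x ∈ A, σ x ∈ A) {d : ℕ} (hd : 0 < d) {φ : ℤ[X]}
    (hφ : φ.Monic) (hφd : φ.natDegree = d) (hφS : (∃ y ∈ A, aeval σ φ e = p ^ 1 • y))
    (hgen : ∀ x ∈ A, ∃ P : ℤ[X], ∃ y ∈ A, x - aeval σ P e = p ^ 1 • y) (j : ℕ) {x : B} (hx : x ∈ A) :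
    ∃ P : ℤ[X], P.natDegree < d ∧ ∃ y ∈ A, x - aeval σ P e = p ^ j • y := by
  induction j with
  | zero => exact ⟨0, by rw [natDegree_zero]; exact hd, x, hx, by rw [map_zero, LinearMap.zero_apply, sub_zero,
      pow_zero, one_smul]⟩
  | succ j ih =>
    obtain ⟨P, hPd, y, hy, hPy⟩ := ih
    obtain ⟨R, hRd, y', hy', hRy⟩ := exists_lt_divAt_one σ hA hd hφ hφd hφS hgen hy
    refine ⟨P + C ((p : ℤ) ^ j) * R, ?_, y', hy', ?_⟩
    · exact (natDegree_add_le _ _).trans_lt (max_lt hPd ((natDegree_C_mul_le _ _).trans_lt hRd))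
    · rw [map_add, LinearMap.add_apply, aeval_C_mul_apply, ← Nat.cast_pow, natCast_zsmul, ← sub_sub, hPy,
        ← smul_sub, hRy, ← mul_smul, pow_one, ← pow_succ]

/-- (1d) A monic `f` of degree `d` with `f·e ∈ p^K A`. [folklore] -/
private theorem exists_monic_divAt (hA : ∀ x ∈ A, σ x ∈ A) (he : e ∈ A) {d : ℕ} (hd : 0 < d) {φ : ℤ[X]}
    (hφ : φ.Monic) (hφd : φ.natDegree = d) (hφS : (∃ y ∈ A, aeval σ φ e = p ^ 1 • y))
    (hgen : ∀ x ∈ A, ∃ P : ℤ[X], ∃ y ∈ A, x - aeval σ P e = p ^ 1 • y) (K : ℕ) :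
    ∃ f : ℤ[X], f.Monic ∧ f.natDegree = d ∧ (∃ y ∈ A, aeval σ f e = p ^ K • y) := by
  obtain ⟨P, hPd, y, hy, hPy⟩ :=
    exists_lt_divAt σ hA hd hφ hφd hφS hgen K (aeval_apply_mem σ hA (X ^ d) he)
  have hdeg : (X ^ d - P : ℤ[X]).natDegree = d := by
    rw [sub_eq_add_neg, natDegree_add_eq_left_of_natDegree_lt (by rwa [natDegree_neg, natDegree_X_pow]),
      natDegree_X_pow]
  refine ⟨X ^ d - P, monic_X_pow_sub (degree_le_natDegree.trans_lt (WithBot.coe_lt_coe.mpr hPd)), hdeg,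
    y, hy, by rw [map_sub, LinearMap.sub_apply, hPy]⟩

/-- (1e) With `f` monic of degree `d` and `f·e ∈ p^K A`: `F·e ∈ p^K A ⇒ F ∈ (f) + p^K ℤ[X]`. [folklore] -/
private theorem exists_eq_mul_add_C_pow_mul (hA : ∀ x ∈ A, σ x ∈ A) (he : e ∈ A) (hp : p.Prime)
    (hnt : ∀ x ∈ A, p • x = 0 → x = 0) {d : ℕ} (hd : 0 < d) (hdmin : ∀ m, (∃ φ : ℤ[X], φ.Monic ∧ φ.natDegree = m ∧ ∃ y ∈ A, aeval σ φ e = p ^ 1 • y) → d ≤ m)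
    {K : ℕ} {f : ℤ[X]} (hf : f.Monic) (hfd : f.natDegree = d) (hfK : (∃ y ∈ A, aeval σ f e = p ^ K • y))
    {F : ℤ[X]} (hF : (∃ y ∈ A, aeval σ F e = p ^ K • y)) : ∃ q r : ℤ[X], F = q * f + C ((p : ℤ) ^ K) * r := by
  have hf1 : f ≠ 1 := fun h ↦ by rw [h, natDegree_one] at hfd; omega
  have hmod : (∃ y ∈ A, aeval σ (F %ₘ f) e = p ^ K • y) := by
    rw [modByMonic_eq_sub_mul_div F f, mul_comm]
    exact divAt_sub σ hF (divAt_mul_left σ hA (F /ₘ f) hfK)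
  obtain ⟨r, hr⟩ := C_pow_dvd_of_divAt σ hA he hp hnt hdmin K hmod (hfd ▸ natDegree_modByMonic_lt F hf hf1)
  exact ⟨F /ₘ f, r, by rw [← hr, mul_comm (F /ₘ f) f, add_comm, modByMonic_add_div F f]⟩

/-- (GL) If `c • a₀ ∈ p^K A` for a non-`p`-divisible `a₀`, then `p^K ∣ c`. [folklore] -/
private theorem pow_dvd_of_zsmul_eq (hp : p.Prime) (hnt : ∀ x ∈ A, p • x = 0 → x = 0) {a₀ : B}
    (ha₀ : a₀ ∈ A) (hndiv : ¬ ∃ y ∈ A, a₀ = p • y) (K : ℕ) {c : ℤ} {y : B} (hy : y ∈ A)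
    (h : c • a₀ = p ^ K • y) : (p : ℤ) ^ K ∣ c := by
  induction K generalizing c y with
  | zero => rw [pow_zero]; exact one_dvd _
  | succ K ih =>
    have hpc : (p : ℤ) ∣ c := by
      by_contra hpc
      obtain ⟨u, v, huv⟩ := ((Nat.prime_iff_prime_int.mp hp).coprime_iff_not_dvd).mpr hpc
      refine hndiv ⟨u • a₀ + v • (p ^ K • y), A.add_mem (A.zsmul_mem ha₀ u) (A.zsmul_mem (A.nsmul_mem hy _) v), ?_⟩
      calc a₀ = (u * (p : ℤ) + v * c) • a₀ := by rw [huv, one_smul]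
        _ = p • (u • a₀ + v • (p ^ K • y)) := by
          rw [add_smul, mul_smul, mul_smul, h, natCast_zsmul, smul_add, smul_comm (p : ℕ) u a₀, pow_succ',
            mul_smul, smul_comm (p : ℕ) v]
    obtain ⟨c', rfl⟩ := hpc
    have h' : c' • a₀ = p ^ K • y := by
      refine nsmul_cancel (A := A) hnt (A.zsmul_mem ha₀ c') (A.nsmul_mem hy _) ?_
      have h2 : (p : ℤ) • (c' • a₀) = (p : ℤ) • (p ^ K • y) := by
        rw [← mul_smul, h, pow_succ', mul_smul, natCast_zsmul]
      simpa only [natCast_zsmul] using h2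
    rw [pow_succ']
    exact mul_dvd_mul_left _ (ih hy h')

/-- **The `Γ`-lift from `p`-adic cyclicity.** Let `σ` be an endomorphism of the additive group `B`,
`p` a prime, `A ≤ B` a `σ`-stable subgroup without `p`-torsion, `e ∈ A` with `σ^N e = e` for some
`N ≥ 1` and such that `A` is `p`-ADICALLY CYCLIC on `e` over `ℤ[σ]` — every `x ∈ A` is `P(σ)e`
modulo `p^K A` for every `K` — and `a₀ ∈ A` a `σ`-fixed element with `a₀ ∉ pA`. Then every `x ∈ A`
with `σx − x ∈ p^k A` lies in `ℤa₀ + p^k A`. (Equivalently: `H¹(⟨σ⟩, A)[p^∞] = 0`, i.e.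
`(A ⊗ ℚ_p/ℤ_p)^σ = A^σ ⊗ ℚ_p/ℤ_p` — for `A = E⁺(ℚ_{2,n})` this is «`r₂⁺` injective», B. D. Kim 2013,
proof of Cor. 3.15, whose printed proof (odd `p`) goes through `(E^±(k_∞) ⊗ ℚ_p/ℤ_p)^∨ ≅ Λ`.)
[cite: BDKim2013, proof of Cor. 3.15 (p. 199)] [cite: Kobayashi2003, Props. 8.11–8.12, Thm. 6.2, Prop. 9.2] -/
theorem exists_sub_zsmul_eq_pow_nsmul_of_cyclic {p : ℕ} (hp : p.Prime) {A : AddSubgroup B}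
    (hA : ∀ x ∈ A, σ x ∈ A) (hnt : ∀ x ∈ A, p • x = 0 → x = 0)
    {e : B} (he : e ∈ A) {N : ℕ} (hN : 0 < N) (hper : (σ ^ N) e = e)
    (hgen : ∀ (K : ℕ), ∀ x ∈ A, ∃ P : ℤ[X], ∃ y ∈ A, x - aeval σ P e = p ^ K • y)
    {a₀ : B} (ha₀ : a₀ ∈ A) (hfix : σ a₀ = a₀) (hndiv : ¬ ∃ y ∈ A, a₀ = p • y)
    {x : B} (hx : x ∈ A) {k : ℕ} (hxk : ∃ w ∈ A, σ x - x = p ^ k • w) :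
    ∃ m : ℤ, ∃ R ∈ A, x - m • a₀ = p ^ k • R := by
  rcases Nat.eq_zero_or_pos k with rfl | hk
  · exact ⟨0, x, hx, by rw [zero_smul, sub_zero, pow_zero, one_smul]⟩
  -- the minimal monic degree `d` of `S = {F : F·e ∈ pA}` and a monic `φ ∈ S` of that degree
  classical
  have hex : ∃ m, (∃ φ : ℤ[X], φ.Monic ∧ φ.natDegree = m ∧ ∃ y ∈ A, aeval σ φ e = p ^ 1 • y) := monicAt_exists σ hN hper
  set d := Nat.find hex with hd_def
  have hdmin : ∀ m, (∃ φ : ℤ[X], φ.Monic ∧ φ.natDegree = m ∧ ∃ y ∈ A, aeval σ φ e = p ^ 1 • y) → d ≤ m := fun m hm ↦ Nat.find_min' hex hm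
  obtain ⟨φ, hφ, hφd, hφS⟩ : (∃ φ : ℤ[X], φ.Monic ∧ φ.natDegree = d ∧ ∃ y ∈ A, aeval σ φ e = p ^ 1 • y) := Nat.find_spec hex
  have hgen1 : ∀ x ∈ A, ∃ P : ℤ[X], ∃ y ∈ A, x - aeval σ P e = p ^ 1 • y := hgen 1
  have hd : 0 < d := by
    by_contra hd0
    have hφ1 : φ = 1 := hφ.natDegree_eq_zero.mp (by omega)
    obtain ⟨y, hy, hey⟩ := hφS
    rw [hφ1, map_one, Module.End.one_apply, pow_one] at hey
    obtain ⟨P, y', hy', hPy'⟩ := hgen1 a₀ ha₀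
    rw [pow_one] at hPy'
    refine hndiv ⟨y' + aeval σ P y, A.add_mem hy' (aeval_apply_mem σ hA P hy), ?_⟩
    rw [smul_add, ← aeval_apply_nsmul, ← hey, ← hPy', sub_add_cancel]
  -- (1d) a monic `f` of degree `d` killing `e` modulo `p^k`, then (2) normalised to `f(1) = 0`
  obtain ⟨f, hfm, hfd, hfK⟩ := exists_monic_divAt σ hA he hd hφ hφd hφS hgen1 k
  obtain ⟨yf, hyf, hfy⟩ := hfK
  have hkill : ∃ z ∈ A, f.eval 1 • a₀ = p ^ k • z := by
    obtain ⟨P₀, y₀, hy₀, hPy₀⟩ := hgen k a₀ ha₀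
    refine ⟨aeval σ P₀ yf + aeval σ f y₀, A.add_mem (aeval_apply_mem σ hA P₀ hyf) (aeval_apply_mem σ hA f hy₀), ?_⟩
    have ha₀' : a₀ = aeval σ P₀ e + p ^ k • y₀ := by rw [← hPy₀]; abel
    calc f.eval 1 • a₀ = aeval σ f a₀ := (aeval_apply_of_fixed σ hfix f).symm
      _ = p ^ k • (aeval σ P₀ yf + aeval σ f y₀) := by
        rw [ha₀', map_add, aeval_comm_apply σ f P₀, hfy, aeval_apply_nsmul, aeval_apply_nsmul, smul_add]
  obtain ⟨z, hz, hfz⟩ := hkill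
  obtain ⟨c, hc⟩ := pow_dvd_of_zsmul_eq hp hnt ha₀ hndiv k hz hfz
  set f₁ : ℤ[X] := f - C (f.eval 1) with hf₁_def
  have hf₁m : f₁.Monic := hfm.sub_of_left (by
    rw [degree_eq_natDegree hfm.ne_zero, hfd]; exact degree_C_le.trans_lt (by exact_mod_cast hd))
  have hf₁d : f₁.natDegree = d := by
    rw [hf₁_def, natDegree_sub_eq_left_of_natDegree_lt (by rw [natDegree_C]; omega), hfd]
  have hf₁K : (∃ y ∈ A, aeval σ f₁ e = p ^ k • y) := by
    have : C (f.eval 1) = C (c * (p : ℤ) ^ k) * 1 := by rw [mul_one, hc, mul_comm]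
    rw [hf₁_def, this]
    exact divAt_sub σ ⟨yf, hyf, hfy⟩ (divAt_C_mul_pow σ hA he k c 1)
  have hroot : f₁.IsRoot 1 := by rw [IsRoot, hf₁_def, eval_sub, eval_C, sub_self]
  set g : ℤ[X] := f₁ /ₘ (X - C 1) with hg_def
  have hg : (X - C 1) * g = f₁ := mul_divByMonic_eq_iff_isRoot.mpr hroot
  -- (3) `b := g·e` is `σ`-fixed modulo `p^k A`
  set b : B := aeval σ g e with hb_def
  have hbA : b ∈ A := aeval_apply_mem σ hA g he
  obtain ⟨yb, hyb, hbyb⟩ : ∃ yb ∈ A, σ b - b = p ^ k • yb := by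
    obtain ⟨yb, hyb, h⟩ := hf₁K
    exact ⟨yb, hyb, by rw [← h, ← hg, aeval_X_sub_one_mul_apply]⟩
  -- every `z ∈ A` with `σ z − z ∈ p^k A` is `c • b` modulo `p^k A`
  have hdecomp : ∀ z ∈ A, (∃ w ∈ A, σ z - z = p ^ k • w) → ∃ c : ℤ, ∃ R ∈ A, z = c • b + p ^ k • R := by
    intro z hzA ⟨w, hw, hzw⟩
    obtain ⟨P, y, hy, hPy⟩ := hgen k z hzA
    have hPe : aeval σ P e = z - p ^ k • y := by rw [← hPy, sub_sub_cancel]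
    have hXP : (∃ y ∈ A, aeval σ ((X - C 1) * P) e = p ^ k • y) := by
      refine ⟨w - (σ y - y), A.sub_mem hw (A.sub_mem (hA y hy) hy), ?_⟩
      rw [aeval_X_sub_one_mul_apply, hPe, map_sub, map_nsmul, smul_sub, smul_sub, ← hzw]
      abel
    obtain ⟨q, r, hqr⟩ := exists_eq_mul_add_C_pow_mul σ hA he hp hnt hd hdmin hf₁m hf₁d hf₁K hXP
    -- evaluate at `1`: `p^k r(1) = 0`, so `r = (X − 1) r₁`
    have hr1 : r.IsRoot 1 := by
      have h1 := congr_arg (eval 1) hqr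
      rw [eval_mul, eval_sub, eval_X, eval_C, sub_self, zero_mul, eval_add, eval_mul, hroot.eq_zero, mul_zero,
        zero_add, eval_mul, eval_C] at h1
      exact (mul_eq_zero.mp h1.symm).resolve_left (pow_ne_zero _ (by exact_mod_cast hp.ne_zero))
    set r₁ : ℤ[X] := r /ₘ (X - C 1) with hr₁_def
    have hr : (X - C 1) * r₁ = r := mul_divByMonic_eq_iff_isRoot.mpr hr1
    -- cancel `X − 1`: `P = q g + p^k r₁`
    have hP : P = q * g + C ((p : ℤ) ^ k) * r₁ := by
      apply mul_left_cancel₀ (X_sub_C_ne_zero (1 : ℤ))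
      rw [hqr, ← hg, ← hr]; ring
    -- `q·b = q(1) • b + (X − 1)q₁·b`
    have hq1 : (q - C (q.eval 1)).IsRoot 1 := by rw [IsRoot, eval_sub, eval_C, sub_self]
    set q₁ : ℤ[X] := (q - C (q.eval 1)) /ₘ (X - C 1) with hq₁_def
    have hq : (X - C 1) * q₁ = q - C (q.eval 1) := mul_divByMonic_eq_iff_isRoot.mpr hq1
    refine ⟨q.eval 1, aeval σ q₁ yb + aeval σ r₁ e + y,
      A.add_mem (A.add_mem (aeval_apply_mem σ hA q₁ hyb) (aeval_apply_mem σ hA r₁ he)) hy, ?_⟩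
    have hqb : aeval σ q b = q.eval 1 • b + p ^ k • aeval σ q₁ yb := by
      have : q = C (q.eval 1) + q₁ * (X - C 1) := by rw [mul_comm, hq]; abel
      nth_rw 1 [this]
      rw [map_add, LinearMap.add_apply, aeval_C_apply, aeval_mul_apply, aeval_X_sub_one_apply, hbyb,
        aeval_apply_nsmul]
    calc z = aeval σ P e + p ^ k • y := by rw [hPe, sub_add_cancel]
      _ = q.eval 1 • b + p ^ k • (aeval σ q₁ yb + aeval σ r₁ e + y) := by
        rw [hP, map_add, LinearMap.add_apply, aeval_mul_apply, ← hb_def, hqb, aeval_C_mul_apply, ← Nat.cast_pow,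
          natCast_zsmul, smul_add, smul_add]
        abel
  -- `a₀ = c₀ • b (mod p^k A)` with `p ∤ c₀`, hence `b = m • a₀ (mod p^k A)`
  obtain ⟨c₀, R₀, hR₀, ha₀b⟩ := hdecomp a₀ ha₀ ⟨0, A.zero_mem, by rw [hfix, sub_self, smul_zero]⟩
  have hpc₀ : ¬ (p : ℤ) ∣ c₀ := by
    rintro ⟨c₁, rfl⟩
    refine hndiv ⟨c₁ • b + p ^ (k - 1) • R₀, A.add_mem (A.zsmul_mem hbA c₁) (A.nsmul_mem hR₀ _), ?_⟩
    rw [ha₀b, smul_add, mul_smul, natCast_zsmul, smul_comm (p : ℕ) c₁ b, ← mul_smul, ← pow_succ',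
      Nat.sub_add_cancel hk]
  obtain ⟨u, m, hum⟩ := (((Nat.prime_iff_prime_int.mp hp).coprime_iff_not_dvd).mpr hpc₀).pow_left (m := k)
  have hbm : b - m • a₀ = p ^ k • (u • b - m • R₀) := by
    calc b - m • a₀ = (u * (p : ℤ) ^ k + m * c₀) • b - m • (c₀ • b + p ^ k • R₀) := by rw [hum, one_smul, ← ha₀b]
      _ = p ^ k • (u • b - m • R₀) := by
        rw [add_smul, mul_smul, mul_smul, smul_add, ← Nat.cast_pow, natCast_zsmul, smul_sub, smul_comm (p ^ k) u b,
          smul_comm (p ^ k) m R₀]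
        abel
  -- conclusion for `x`
  obtain ⟨c, R, hR, hxb⟩ := hdecomp x hx hxk
  refine ⟨c * m, c • (u • b - m • R₀) + R, A.add_mem (A.zsmul_mem (A.sub_mem (A.zsmul_mem hbA u)
    (A.zsmul_mem hR₀ m)) c) hR, ?_⟩
  rw [hxb, mul_smul, smul_add, smul_comm (p ^ k) c, ← hbm, smul_sub]
  abel

end Cyclic

end Summit.BirchSwinnertonDyer.BirchSwinnertonDyer.Theorems.SignedEC.CyclicLift

end
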